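import Literature.Geometry.DiscreteGeometry.TammesThirteenOptimal
import Literature.Geometry.DiscreteGeometry.KissingNumberThreeProofs
import HarnessLib

/-!
# The proved bracket `57.1367° ≤ d₁₃ < 60°` for the Tammes number of thirteen points

Theorem-only companion of `TammesThirteenOptimal.lean` (`d_N = maxMinDist`; the named fact
`musinTarasov2012_tammes_thirteen` of `TammesThirteen.lean` is EQUIVALENT to the chordal
inequality `d₁₃ < 0.957`, and `d₁₃ ≥ 0.9564136` from the explicit arrangement `P₁₃`).  Here the
best upper bound PROVED in the tree is recorded: **`d₁₃ < 1` (chordal), i.e. `d₁₃ < 60°`**, a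
restatement of the kissing number `k(3) = 12` (`musin2006_kissing_three_holds`, proved in
`KissingNumberThreeProofs.lean` by Musin's Delsarte-type argument): thirteen unit vectors with
pairwise angular separation `≥ 60°` do not exist.  Musin–Tarasov (§1, p. 3) recall the history of
the upper bounds: "`d₁₃ < 60°`" is the thirteen spheres problem (Schütte–van der Waerden 1953),
"`d₁₃ < 58.7°`" (Böröczky–Szabó 2003) and "`d₁₃ < 58.5°`" (Bachoc–Vallentin, SDP), while Theorem 1
gives `d₁₃ = δ₁₃ ≈ 57.1367°`; the named fact (`< 57.175°`) thus lies strictly between what is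
proved here and the computer-assisted Theorem 1.

## References
* O. R. Musin, A. S. Tarasov, Discrete Comput. Geom. 48 (2012) 128–141, §1 and Theorem 1.
  [`MusinTarasov2012`]
* O. R. Musin, *The kissing problem in three dimensions*, Discrete Comput. Geom. 35 (2006)
  375–384. [`Musin2005`]
-/

noncomputable section

namespace Literature.Geometry.DiscreteGeometry

open Finset

/-- **`d₁₃ < 60°` (chordal: `d₁₃ < 1`) — the thirteen spheres theorem in the language of the
Tammes number**, from the proved kissing bound `musin2006_kissing_three_holds`: a maximal
arrangement of `13` points with `ψ ≥ 1` would be thirteen unit vectors with pairwise distances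
`≥ 1`. [cite: MusinTarasov2012, §1 ("d₁₃ < 60°", the thirteen spheres problem)]
[cite: Musin2005, p. 4 Theorem (k(3) = 12)] -/
theorem maxMinDist_thirteen_lt_one : maxMinDist 13 (EuclideanSpace ℝ (Fin 3)) < 1 := by
  obtain ⟨x, hx, he⟩ := exists_minDist_eq_maxMinDist (E := EuclideanSpace ℝ (Fin 3)) 13
  rw [← he]
  by_contra hge
  push Not at hge
  have hne : (distinctPairs 13).Nonempty := distinctPairs_nonempty (i := 0) (j := 1) (by decide)
  obtain ⟨T, hTc, hT1, hTd⟩ := exists_finset_of_le_minDist hx hne one_pos hge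
  have := musin2006_kissing_three_holds T hT1 hTd
  omega

/-- **The proved bracket** `0.9564136 ≤ d₁₃ < 1` (i.e. `57.1367° ≤ d₁₃ < 60°`); the named fact
`musinTarasov2012_tammes_thirteen` asserts `d₁₃ < 0.957` (`< 57.175°`), inside this bracket.
[cite: MusinTarasov2012, Theorem 1 and §1] -/
theorem maxMinDist_thirteen_mem_Ico :
    maxMinDist 13 (EuclideanSpace ℝ (Fin 3)) ∈ Set.Ico (0.9564136 : ℝ) 1 :=
  ⟨le_maxMinDist_thirteen, maxMinDist_thirteen_lt_one⟩

/-- Hence **every arrangement of thirteen unit vectors of `ℝ³` has two at (chordal) distance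
`< 1`, i.e. at angular separation `< 60°`** — `ψ(x) < 1` for every `x`. [cite: Musin2005,
p. 4 Theorem (k(3) = 12)] -/
theorem minDist_thirteen_lt_one {x : Fin 13 → EuclideanSpace ℝ (Fin 3)}
    (hx : x ∈ unitConfigs 13 (EuclideanSpace ℝ (Fin 3))) : minDist x < 1 :=
  (minDist_le_maxMinDist hx).trans_lt maxMinDist_thirteen_lt_one

end Literature.Geometry.DiscreteGeometry

end
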